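/-
Copyright: cell pub-balaban-gaps (YM BLITZ Y1, track G1), seat g1-p2 GEN 4 (unit `pub-balaban-gaps-g1-p2`).  Row (D4), OBJECT ∕
MECHANISM level: the (v)⁺ shape `ExistsUniformAcrossSmall` INHABITED by glued model (2.14)-terms read in the BLOCK currency — the
σ-mechanism GEOMETRIC, the precision mechanism `α ∕ R`, AND the Neumann margin `q = O(λ_R)` at fixed cube geometry (print's
*"M sufficiently large"* regime), all three at once.  HONEST FRAMING: a MODEL; nothing of Bałaban's constructed or asserted; (D4)
NOT discharged (instance 0∕1); NOT BetaPertH, NOT continuum, NOT Clay.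
-/
import Summits.QuantumFields.BalabanUV.Gaps.D4WalkModelGlued
import Summits.QuantumFields.BalabanUV.Gaps.D4WalkBlockOneScale

/-!
# `Gaps.D4WalkModelGluedBlock` — (v)⁺ inhabited in block currency: geometric σ-smallness, free precision, margin `O(λ_R)` (cell pub-balaban-gaps, seat g1-p2 gen 4)

HONEST DEPENDENCY (cell pub-balaban, verbatim): continuum YM on T⁴ ⇐ BetaPertH ∧ nine spine estimates (0/9 proved);
BetaPertH ⇐ (D1) ∧ (D4) ∧ CAP+tail.

`D4WalkModelGlued` (INTENT-25) inhabits the row's first-missing-lemma SHAPE `ExistsUniformAcrossSmall` by (2.14)-model terms whose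
Γ-kernel is the glued one-scale inverse `S·(1 − R)⁻¹` over domain-localised seed ∕ step data, read in the FLAT currency: its
Neumann margin `q = (m_Nc_μ)²·K̄_R·c_μ²` carries the middle fibre `m_N` and SITE row sums — the located limit V47.  THIS FILE is
the same construction read in the BLOCK currency of `D4WalkBlock` ∕ `D4WalkBlockOneScale` (INTENT-26 … 31): the datum
`GluedModelTerm` is unchanged (its locators ARE the cube maps, its torus the cube torus), the hypotheses are the block-local ones
(`D4WalkBlockLocal.IsDomainLocalB`: OPERATOR-norm letters `λ_S`, `λ_R`), and the margin is `q = c_μ(c_μ·1·(1·K̄_R)c_μ)c_μ`,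
`K̄_R = λ_Re^{κ₁m_J}e^{2ρ₀r}e^{μr}n_Dc_μ` — NO fibre letter; at cube rates `r, ρ₀, μ = O(1)`, `n_D, c_μ = O(1)` this is `O(λ_R)`.
`termWalkData_block`: `TermWalkData` with ONE torus-free package; `acrossSmall_glued_block`: (v)⁺ across any
family of glued model members with common letters — σ-smallness by GEOMETRY (`e^{−(ε₀−3μ)R_σ}`, rows `R_σ` cube steps from the
σ-region), precision free (`α ∕ R`), margin `O(λ_R)`: print's three sources of smallness ([II] p. 13, p. 15–16; [B9] Thm 3.7
*"M sufficiently large"*) in print's regimes, at the model level.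
WHAT IT IS NOT: Bałaban's (2.14) terms, `Δ′`, `G′_□`, `h_□`, (3.89) are NOT constructed ∕ proved — `S`, `R` and their block
letters are DATA ∕ HYPOTHESES; the multi-scale structure, k-uniformity beyond "common letters", and `TermDomination` remain;
(D4) instance 0∕1; words UNCHANGED.
-/

noncomputable section

namespace Summit.QuantumFields.BalabanUV.Gaps.D4WalkModelGluedBlock

open Metric Set Finset
open Literature.MathematicalPhysics.QuantumFieldTheory.Balaban1983to89
open Literature.MathematicalPhysics.QuantumFieldTheory.Balaban1983to89.B9SectDWalk (Through MajSumLe DomBy)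
open Literature.MathematicalPhysics.QuantumFieldTheory.Balaban1983to89.B9Thm34Ext (toB6)
open Literature.MathematicalPhysics.QuantumFieldTheory.Balaban1983to89.B9Thm37GlueTorus (torusGeom tdist1 tdist1_nonneg)
open Literature.MathematicalPhysics.QuantumFieldTheory.Balaban1983to89.TreeLengthTorus (TPt)
open Literature.MathematicalPhysics.QuantumFieldTheory.Balaban1983to89.B5TorusCover (UT)
open Literature.MathematicalPhysics.QuantumFieldTheory.Balaban1983to89.B11SectG (RowSum)
open Literature.MathematicalPhysics.QuantumFieldTheory.Balaban1983to89.B13JointWalkExpansion (JointWalkExpansion WalkMajorants)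
open Literature.MathematicalPhysics.QuantumFieldTheory.Balaban1983to89.B13TermWalkData
  (WalkConsts TermKernels TermWalkData TorusTerms)
open Literature.MathematicalPhysics.QuantumFieldTheory.Balaban1983to89.B13TermWalkDataOneTorus
  (SmallTheta ExistsUniformAcrossSmall acrossSmall_of_decay)
open Literature.MathematicalPhysics.QuantumFieldTheory.Balaban1983to89.B13DomainKernelWalks (DomainTerms)
open Summit.QuantumFields.BalabanUV.Gaps.D4WalkModelAcross (ModelTerm)
open Summit.QuantumFields.BalabanUV.Gaps.D4WalkModelGlued (GluedModelTerm GluedModelMember)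
open Summit.QuantumFields.BalabanUV.Gaps.D4WalkBlockLocal (IsDomainLocalB)
open Summit.QuantumFields.BalabanUV.Gaps.D4WalkBlockOneScale (jointWalkExpansion_oneScale_block)

/-! ## §1. `TermWalkData` for the glued model term, block letters -/

section Model

variable {d N' : ℕ} {ν : ℕ} {Nf : Fin ν → ℕ} [∀ i, NeZero (Nf i)]
variable {E : Type*} [NormedAddCommGroup E] [NormedSpace ℂ E]
variable {c : B13.Consts} {t : GluedModelTerm d N' ν Nf E}

/-- **`TermWalkData` FOR THE GLUED MODEL TERM, BLOCK LETTERS.**  Seed `S` and step `R` block-local over the term's locators read as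
cube maps, letters `(R, λ_S ∕ λ_R, r, m_J, n_D)` (`λ_•, κ₁ ≥ 0`); one cube row-sum rate `μ` (constant `c_μ ≥ 0`); rates `0 ≤ μ`,
`3μ ≤ ε₀`, `2μ ≤ κ₀`, `κ₀ + μ ≤ ρ₀ − ε₀`; margin `q = c_μ(c_μ·1·(1·K̄_R)c_μ)c_μ < 1` (NO fibre letter); rows `R_σ`-far from `X`.
Package: `(R, ε₀ − 3μ, κ₀ − 2μ, K̄_glued, 1, 1, R_σ)`, `K̄_glued = c_μ·K̄_S·(1·(1 − q)⁻¹)·c_μ`, `K̄_• = λ_•e^{κ₁m_J}e^{2ρ₀r}e^{μr}n_Dc_μ`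
— no letter depends on the torus. [cite: Balaban1985BackgroundPropagators, (3.87)–(3.90) p.409, Thm 3.10 p.416, p.422; Balaban1988RG2Cluster, (1.11) p.5, p.13, p.15] -/
theorem termWalkData_block {R lamS lamR r : ℝ} {mJ nD : ℕ} {ρ₀ ε₀ κ₀ μ cμ Rσ : ℝ}
    (hS : IsDomainLocalB t.S c t.locΛ t.locN t.X R lamS r mJ nD) (hR : IsDomainLocalB t.R c t.locN t.locN t.X R lamR r mJ nD)
    (hκ₁ : 0 ≤ c.κ₁) (hlamS : 0 ≤ lamS) (hlamR : 0 ≤ lamR)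
    (hμ : 0 ≤ μ) (hμε : 3 * μ ≤ ε₀) (hμκ : 2 * μ ≤ κ₀) (hwin : κ₀ + μ ≤ ρ₀ - ε₀) (hcμ : 0 ≤ cμ)
    (hrow : RowSum (toB6 (torusGeom Nf 0 0 0) 0 True) μ cμ)
    (hq : cμ * (cμ * 1 *
      (1 * ((lamR * Real.exp (c.κ₁ * mJ) * Real.exp (2 * ρ₀ * r)) * Real.exp (μ * r) * (nD * cμ))) * cμ) * cμ < 1)
    (hfar : ∀ b : t.Λ, ∀ z ∈ t.X, Rσ ≤ tdist1 Nf (t.locΛ b) z) :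
    TermWalkData (t.toKernels c)
      ⟨R, ε₀ - 3 * μ, κ₀ - 2 * μ,
        cμ * ((lamS * Real.exp (c.κ₁ * mJ) * Real.exp (2 * ρ₀ * r)) * Real.exp (μ * r) * (nD * cμ)) *
          (1 * (1 - cμ * (cμ * 1 *
            (1 * ((lamR * Real.exp (c.κ₁ * mJ) * Real.exp (2 * ρ₀ * r)) * Real.exp (μ * r) * (nD * cμ))) * cμ) * cμ)⁻¹) * cμ,
        1, 1, Rσ⟩ := by
  obtain ⟨W, T, SX, A, D, ρ', hJ, -⟩ :=
    jointWalkExpansion_oneScale_block hS hR hκ₁ hlamS hlamR hμ hμε hμκ hwin hcμ hrow hq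
  refine ⟨⟨W, T, SX, A, D, ρ', hJ⟩, ?_, ?_, hfar⟩
  · exact ⟨Unit, fun _ _ _ => 1, ∅, fun _ => 1, fun _ => tdist1 Nf, (κ₀ - 2 * μ) + (ε₀ - 3 * μ),
      ModelTerm.jointWalkExpansion_one (d := d) (N' := N') (E := E) c t.locΛ t.X R (ε₀ - 3 * μ) (κ₀ - 2 * μ)⟩
  · exact ⟨Unit, fun _ _ _ => (1 : Matrix t.Λ t.Λ ℂ)⁻¹, fun _ => 1, fun _ => tdist1 Nf, κ₀ - 2 * μ,
      ModelTerm.walkMajorants_one_inv (d := d) (N' := N') (E := E) c t.locΛ R (κ₀ - 2 * μ)⟩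

end Model

/-! ## §2. (v)⁺ across a family of glued model members, block letters -/

section Across

variable {d : ℕ} {c : B13.Consts}

/-- **(v)⁺ ACROSS A FAMILY OF GLUED MODEL MEMBERS, BLOCK LETTERS — σ-smallness by GEOMETRY, margin `O(λ_R)`.**  Common letters
`(R, λ_S, λ_R, r, m_J, n_D)`, one cube row-sum rate `μ` with constant `c_μ` on every member's cube torus, rates as in §1 with
`2μ < κ₀`, margin `q = c_μ(c_μ·1·(1·K̄_R)c_μ)c_μ < 1`, `hfar` at `Rσ₀`, numerics `0 ≤ α < R` and
`2·max(K̄_glued, 1)·(e^{−(ε₀−3μ)Rσ₀} + α∕R) ≤ θ₀` ⟹ `ExistsUniformAcrossSmall (fun s => (𝓜 s).toTorusTerms c) α Rσ₀ θ₀`.  No fibre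
letter anywhere: `λ_R` is constrained by `q < 1` ALONE at fixed cube geometry; the σ-line is met by `Rσ₀` large and `α∕R` small.
[cite: Balaban1988RG2Cluster, (1.11) p.5, p.13, p.15; Balaban1985BackgroundPropagators, Thm 3.7 p.409, Thm 3.10 p.416] -/
theorem acrossSmall_glued_block {S : Type*} (𝓜 : S → GluedModelMember d) {R lamS lamR r : ℝ} {mJ nD : ℕ}
    {ρ₀ ε₀ κ₀ μ cμ Rσ₀ α θ₀ : ℝ}
    (hS : ∀ s (i : (𝓜 s).ι), IsDomainLocalB ((𝓜 s).t i).S c ((𝓜 s).t i).locΛ ((𝓜 s).t i).locN ((𝓜 s).t i).X R lamS r mJ nD)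
    (hR : ∀ s (i : (𝓜 s).ι), IsDomainLocalB ((𝓜 s).t i).R c ((𝓜 s).t i).locN ((𝓜 s).t i).locN ((𝓜 s).t i).X R lamR r mJ nD)
    (hrow : ∀ s, RowSum (toB6 (torusGeom (𝓜 s).Nf 0 0 0) 0 True) μ cμ)
    (hfar : ∀ s (i : (𝓜 s).ι) (b : ((𝓜 s).t i).Λ), ∀ z ∈ ((𝓜 s).t i).X, Rσ₀ ≤ tdist1 (𝓜 s).Nf (((𝓜 s).t i).locΛ b) z)
    (hκ₁ : 0 ≤ c.κ₁) (hlamS : 0 ≤ lamS) (hlamR : 0 ≤ lamR) (hμ : 0 ≤ μ) (hμε : 3 * μ ≤ ε₀) (hμκ : 2 * μ < κ₀)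
    (hwin : κ₀ + μ ≤ ρ₀ - ε₀) (hcμ : 0 ≤ cμ)
    (hq : cμ * (cμ * 1 *
      (1 * ((lamR * Real.exp (c.κ₁ * mJ) * Real.exp (2 * ρ₀ * r)) * Real.exp (μ * r) * (nD * cμ))) * cμ) * cμ < 1)
    (hα : 0 ≤ α) (hαR : α < R)
    (hθ : 2 * max (cμ * ((lamS * Real.exp (c.κ₁ * mJ) * Real.exp (2 * ρ₀ * r)) * Real.exp (μ * r) * (nD * cμ)) *
          (1 * (1 - cμ * (cμ * 1 *
            (1 * ((lamR * Real.exp (c.κ₁ * mJ) * Real.exp (2 * ρ₀ * r)) * Real.exp (μ * r) * (nD * cμ))) * cμ) * cμ)⁻¹) * cμ) 1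
        * (Real.exp (-((ε₀ - 3 * μ) * Rσ₀)) + α / R) ≤ θ₀) :
    ExistsUniformAcrossSmall (fun s => (𝓜 s).toTorusTerms c) α Rσ₀ θ₀ := by
  have hq1 : 0 < 1 - cμ * (cμ * 1 *
      (1 * ((lamR * Real.exp (c.κ₁ * mJ) * Real.exp (2 * ρ₀ * r)) * Real.exp (μ * r) * (nD * cμ))) * cμ) * cμ := by linarith
  have hK : 0 ≤ cμ * ((lamS * Real.exp (c.κ₁ * mJ) * Real.exp (2 * ρ₀ * r)) * Real.exp (μ * r) * (nD * cμ)) *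
      (1 * (1 - cμ * (cμ * 1 *
        (1 * ((lamR * Real.exp (c.κ₁ * mJ) * Real.exp (2 * ρ₀ * r)) * Real.exp (μ * r) * (nD * cμ))) * cμ) * cμ)⁻¹) * cμ := by
    positivity
  exact acrossSmall_of_decay
    ⟨R, ε₀ - 3 * μ, κ₀ - 2 * μ,
      cμ * ((lamS * Real.exp (c.κ₁ * mJ) * Real.exp (2 * ρ₀ * r)) * Real.exp (μ * r) * (nD * cμ)) *
        (1 * (1 - cμ * (cμ * 1 *
          (1 * ((lamR * Real.exp (c.κ₁ * mJ) * Real.exp (2 * ρ₀ * r)) * Real.exp (μ * r) * (nD * cμ))) * cμ) * cμ)⁻¹) * cμ,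
      1, 1, Rσ₀⟩
    ⟨hαR, by linarith, by linarith, hK, zero_le_one, zero_le_one, le_rfl⟩
    (fun s i => termWalkData_block (hS s i) (hR s i) hκ₁ hlamS hlamR hμ hμε hμκ.le hwin hcμ (hrow s) hq (hfar s i))
    (le_max_left _ _) (le_max_right _ _) hα hθ

end Across

end Summit.QuantumFields.BalabanUV.Gaps.D4WalkModelGluedBlock

end
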